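import Literature.NumberTheory.Weil1964.ArchDualPairThetaMajorants
import Literature.NumberTheory.Weil1964.ArchLeviKAKInputTwoPlanes
import HarnessLib

/-!
# Weil's theta majorants for the CM unitary dual pair — the rank profile (J3): first factor of real rank TWO at a place

Topic `NumberTheory/Weil1964`; namespace `Literature.NumberTheory.Weil1964`.  THEOREMS ONLY (no definition, no record,
no `Prop`-valued definition, no hypothesis of print).  Continuation of ★ `ArchDualPairThetaMajorants` §0, whose per-place
Levi-form `KAK` kinds are (J1) «first factor of real rank `≤ 1`, second compact» (`LeviKAKInput.junction`) and (J2) «first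
compact, second of real rank `≤ 1`» (`.junctionSwap`/`.junctionCompact`).  With ★ `LeviKAKInput.junctionTwo`
(`ArchLeviKAKInputTwoPlanes`, two disjoint hyperbolic planes, word ★ `RealUnitaryKAKPair` over ★ `RealUnitaryKAK`) the tree
now also covers

* (J3) «first factor of real rank EXACTLY TWO (two planes exhausting `P` or `Q`), second factor compact»
  (`nonempty_anyLeviKAKInput_of_rankTwo`), in canonical sign frames «exactly two non-positive entries of `x`, at least two
  positive ones, `y` of constant sign» (`nonempty_anyLeviKAKInput_of_signs_twoTwo`);
* the CM per-place form with the TRIVIAL sign convention `c_V ≡ 1`: through every complex embedding `τ` the real numbers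
  `re τ(d_V i)` have exactly two negative entries `i₀ ≠ i₁`, two named positive ones `j₀ ≠ j₁` and all others positive, and
  the `re τ(d_W j)` a common strict sign (`nonempty_anyLeviKAKInput_cm_twoTwo`) — the profile of the DOUBLED frame
  `V ⊕ (−V)` of a definite hermitian plane `V` (signature `(2,2)` at every real place) against a line `W`;
* **`hasThetaMajorants_cmPairSplitting_twoTwo`** — the CM pin `hρ` of `GelbartRogawski1991.UnitaryDualPair.cmThetaKernelDatum`
  for such data, from ★ `hasThetaMajorants_cmPairSplitting_canonical` at `c_V ≡ 1`.

Consumer: the archimedean theta majorants O42.9 of the doubled pair `(U(2,2)_{dD}, U(1)_{a′})` of [Liu2021, App. B]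
(KAK-U22 (iii); the `pairRep`/`chiSplittingLine` dress is `Liu2021.ThetaLiftFromLineMajorantsRankTwo`).

References: [Weil1964] A. Weil, Acta Math. 111 (1964), Chap. III n° 41 Lemme 5 p. 194, Théorème 6 (1) p. 193;
[GelbartRogawski1991] Invent. Math. 105 (1991) §3.1 Prop. 3.1.1 p. 455; [KonnoKonno2007] §3.1 (3.1); [Folland1989] §4.2
(4.24) pp. 178–179, Prop. (4.39) pp. 183–184; [Knapp2002] Thm 7.39.
-/

set_option autoImplicit false

noncomputable section

open scoped Matrix Real Classical ComplexConjugate Kronecker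
open Complex NumberField NumberField.InfinitePlace NumberField.mixedEmbedding IsDedekindDomain
open Literature.NumberTheory.Automorphic Literature.NumberTheory.Automorphic.UnitaryGroup
open Literature.RepresentationTheory.HeisenbergGroup Literature.Analysis.SegalBargmann
open Literature.RepresentationTheory.KonnoKonno2007 Literature.RepresentationTheory.KonnoKonno2007.RealDualPair

namespace Literature.NumberTheory.Weil1964

/-! ## §0 (J3) The rank profile «first factor of real rank two, second factor compact» -/

section RealPairKindsTwo

variable {P Q R S : Type} [Fintype P] [DecidableEq P] [Fintype Q] [DecidableEq Q] [Fintype R] [DecidableEq R]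
  [Fintype S] [DecidableEq S]

/-- **Rank profile (J3): first factor of real rank two (two disjoint planes `(p₀,q₀)`, `(p₁,q₁)` exhausting `P` or `Q`),
second factor compact (`R` or `S` empty)** — the tree's Levi-form `KAK` input is ★ `LeviKAKInput.junctionTwo`.
[cite: KonnoKonno2007, §3.1 (3.1); Folland1989, §4.2 (4.24) pp. 178–179, Prop. (4.39) pp. 183–184; Knapp2002, Thm 7.39] -/
theorem nonempty_anyLeviKAKInput_of_rankTwo (p₀ p₁ : P) (hp : p₀ ≠ p₁) (q₀ q₁ : Q) (hq : q₀ ≠ q₁)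
    (hPQ : (∀ a : P, a = p₀ ∨ a = p₁) ∨ (∀ b : Q, b = q₀ ∨ b = q₁)) (hRS : IsEmpty R ∨ IsEmpty S) :
    Nonempty (AnyLeviKAKInput (fun g : Ginf P Q R S =>
      (⇑((ι𝕎 P Q R S g).1 : ((DPIdx P Q R S → ℝ) × (DPIdx P Q R S → ℝ)) ≃ₗ[ℝ]
        ((DPIdx P Q R S → ℝ) × (DPIdx P Q R S → ℝ))) : PhaseMap (DPIdx P Q R S)))) := by
  have hW : Function.Surjective (UForm.kV R S) := hRS.elim (fun _ => UForm.kV_surjective_of_isEmpty_left)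
    fun _ => UForm.kV_surjective_of_isEmpty_right
  exact ⟨⟨DPK P Q R S, ℝ × ℝ, κ P Q R S, _, LeviKAKInput.junctionTwo p₀ p₁ q₀ q₁ hp hq hPQ hW⟩⟩

end RealPairKindsTwo

section SignFrameKindsTwo

variable {N M : ℕ}

/-- **Rank profile (J3) in canonical sign frames**: `x` with exactly two non-positive entries `i₀ ≠ i₁`, two named
positive entries `j₀ ≠ j₁` (first factor `U(≥2, 2)`, planes `(j₀,i₀)`, `(j₁,i₁)`), and `y` of constant sign (second factor
definite). [cite: KonnoKonno2007, §3.1 (3.1); Folland1989, §4.2 (4.24) pp. 178–179, Prop. (4.39) pp. 183–184; Knapp2002, Thm 7.39] -/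
theorem nonempty_anyLeviKAKInput_of_signs_twoTwo {x : Fin N → ℝ} {y : Fin M → ℝ} (j₀ j₁ i₀ i₁ : Fin N)
    (hj : j₀ ≠ j₁) (hi : i₀ ≠ i₁) (hj₀ : 0 < x j₀) (hj₁ : 0 < x j₁) (hi₀ : ¬0 < x i₀) (hi₁ : ¬0 < x i₁)
    (hrest : ∀ i, i ≠ i₀ → i ≠ i₁ → 0 < x i) (hy : (∀ j, 0 < y j) ∨ ∀ j, y j < 0) :
    Nonempty (AnyLeviKAKInput (fun g : Ginf (PosIdx x) (NegIdx x) (PosIdx y) (NegIdx y) =>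
      (⇑((ι𝕎 (PosIdx x) (NegIdx x) (PosIdx y) (NegIdx y) g).1 :
          ((DPIdx (PosIdx x) (NegIdx x) (PosIdx y) (NegIdx y) → ℝ) ×
              (DPIdx (PosIdx x) (NegIdx x) (PosIdx y) (NegIdx y) → ℝ)) ≃ₗ[ℝ]
            ((DPIdx (PosIdx x) (NegIdx x) (PosIdx y) (NegIdx y) → ℝ) ×
              (DPIdx (PosIdx x) (NegIdx x) (PosIdx y) (NegIdx y) → ℝ))) :
        PhaseMap (DPIdx (PosIdx x) (NegIdx x) (PosIdx y) (NegIdx y))))) :=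
  nonempty_anyLeviKAKInput_of_rankTwo ⟨j₀, hj₀⟩ ⟨j₁, hj₁⟩ (fun h => hj (congrArg Subtype.val h)) ⟨i₀, hi₀⟩ ⟨i₁, hi₁⟩
    (fun h => hi (congrArg Subtype.val h))
    (Or.inr fun q => by
      by_cases h₀ : q.1 = i₀
      · exact Or.inl (Subtype.ext h₀)
      · by_cases h₁ : q.1 = i₁
        · exact Or.inr (Subtype.ext h₁)
        · exact absurd (hrest q.1 h₀ h₁) q.2)
    (hy.elim (fun h => Or.inr (isEmpty_negIdx h)) fun h => Or.inl (isEmpty_posIdx h))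

end SignFrameKindsTwo

/-! ## §1 The CM per-place kind and the CM pin for the profile «`(≥2, 2)` at every real place, `W` definite» -/

section CMTwo

variable (L : Type) [Field L] [NumberField L] [IsCMField L]

variable {N M n : ℕ} (e : Fin N × Fin M ≃ Fin n)
  (dV : Fin N → L) (hdV : ∀ i, IsCMField.complexConj L (dV i) = dV i) (hdV0 : ∀ i, dV i ≠ 0)
  (dW : Fin M → L) (hdW : ∀ i, IsCMField.complexConj L (dW i) = dW i) (hdW0 : ∀ i, dW i ≠ 0)

/-- **The per-place Levi-form `KAK` kind (J3) from sign facts through complex embeddings, trivial sign convention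
`c_V ≡ 1`**: through every complex embedding `τ` the `re τ(d_V i)` have exactly two negative entries `i₀ ≠ i₁`, two named
positive ones `j₀ ≠ j₁` and all others positive; the `re τ(d_W j)` have a common strict sign.
[cite: KonnoKonno2007, §3.1 (3.1); Folland1989, §4.2 (4.24) pp. 178–179, Prop. (4.39) pp. 183–184; Knapp2002, Thm 7.39] -/
theorem nonempty_anyLeviKAKInput_cm_twoTwo
    (h22 : ∀ τ : L →+* ℂ, ∃ i₀ i₁ j₀ j₁ : Fin N, i₀ ≠ i₁ ∧ j₀ ≠ j₁ ∧ (τ (dV i₀)).re < 0 ∧ (τ (dV i₁)).re < 0 ∧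
      0 < (τ (dV j₀)).re ∧ 0 < (τ (dV j₁)).re ∧ ∀ i, i ≠ i₀ → i ≠ i₁ → 0 < (τ (dV i)).re)
    (hW : ∀ τ : L →+* ℂ, (∀ j, 0 < (τ (dW j)).re) ∨ ∀ j, (τ (dW j)).re < 0)
    (v : {v : InfinitePlace ↥(maximalRealSubfield L) // v.IsReal}) :
    Nonempty (AnyLeviKAKInput (fun g : Ginf
        (PosIdx (placeSignVec (cmRealVec L dV hdV) (fun _ => (1 : ℝ)) v))
        (NegIdx (placeSignVec (cmRealVec L dV hdV) (fun _ => (1 : ℝ)) v))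
        (PosIdx (placeSignVec (cmRealVec L dW hdW) (fun v =>
          ((cmPlaceOver L v).1.embedding (GelbartRogawski1991.UnitaryDualPair.imagUnit L)).im / (fun _ => (1 : ℝ)) v) v))
        (NegIdx (placeSignVec (cmRealVec L dW hdW) (fun v =>
          ((cmPlaceOver L v).1.embedding (GelbartRogawski1991.UnitaryDualPair.imagUnit L)).im / (fun _ => (1 : ℝ)) v) v)) =>
      (⇑((ι𝕎 _ _ _ _ g).1 : ((DPIdx _ _ _ _ → ℝ) × (DPIdx _ _ _ _ → ℝ)) ≃ₗ[ℝ] ((DPIdx _ _ _ _ → ℝ) × (DPIdx _ _ _ _ → ℝ))) :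
        PhaseMap (DPIdx
          (PosIdx (placeSignVec (cmRealVec L dV hdV) (fun _ => (1 : ℝ)) v))
          (NegIdx (placeSignVec (cmRealVec L dV hdV) (fun _ => (1 : ℝ)) v))
          (PosIdx (placeSignVec (cmRealVec L dW hdW) (fun v =>
            ((cmPlaceOver L v).1.embedding (GelbartRogawski1991.UnitaryDualPair.imagUnit L)).im / (fun _ => (1 : ℝ)) v) v))
          (NegIdx (placeSignVec (cmRealVec L dW hdW) (fun v =>
            ((cmPlaceOver L v).1.embedding (GelbartRogawski1991.UnitaryDualPair.imagUnit L)).im / (fun _ => (1 : ℝ)) v) v)))))) := by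
  have him := im_embedding_cmPlaceOver_imagUnit_ne_zero L v
  have hτ : (InfinitePlace.mk (cmPlaceOver L v).1.embedding).comap (algebraMap (↥(maximalRealSubfield L)) L) = v.1 := by
    rw [mk_embedding]; exact cmPlaceOver_comap L v
  obtain ⟨i₀, i₁, j₀, j₁, hi, hj, hi₀, hi₁, hj₀, hj₁, hrest⟩ := h22 (cmPlaceOver L v).1.embedding
  refine nonempty_anyLeviKAKInput_of_signs_twoTwo j₀ j₁ i₀ i₁ hj hi ?_ ?_ ?_ ?_ (fun i h₀ h₁ => ?_) ?_
  · rw [placeSignVec_cmRealVec L v _ hτ, div_one]; exact hj₀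
  · rw [placeSignVec_cmRealVec L v _ hτ, div_one]; exact hj₁
  · rw [placeSignVec_cmRealVec L v _ hτ, div_one, not_lt]; exact hi₀.le
  · rw [placeSignVec_cmRealVec L v _ hτ, div_one, not_lt]; exact hi₁.le
  · rw [placeSignVec_cmRealVec L v _ hτ, div_one]; exact hrest i h₀ h₁
  · refine (forall_pos_or_forall_neg_div (hW (cmPlaceOver L v).1.embedding) (div_ne_zero him one_ne_zero)).imp
      (fun h j => ?_) fun h j => ?_ <;> rw [placeSignVec_cmRealVec L v _ hτ] <;> exact h j

/-- **The CM pin for the profile (J3) — the hypothesis `hρ` of `cmThetaKernelDatum` from SIGN FACTS through complex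
embeddings**: through every `τ : L →+* ℂ` the real numbers `re τ(d_V i)` have exactly two negative entries, two named
positive ones and all others positive (the real pair at every place is `U(N−2, 2) × U(M, 0)` up to the orientation of
`W`: ★ `LeviKAKInput.junctionTwo`), the `re τ(d_W j)` a common strict sign.  Then `(u₁, u₂) ↦ ω_ψ(s_pair(u₁, u₂))`
`HasThetaMajorants` (★ `hasThetaMajorants_cmPairSplitting_canonical` at the trivial sign convention `c_V ≡ 1`).
[cite: Weil1964, Chap. III n° 41 Lemme 5 p. 194, Théorème 6 (1) p. 193; GelbartRogawski1991, §3.1 Prop. 3.1.1 p. 455; KonnoKonno2007, §3.1 (3.1); Folland1989, §4.2 (4.24) pp. 178–179, Prop. (4.39) pp. 183–184; Knapp2002, Thm 7.39] -/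
theorem hasThetaMajorants_cmPairSplitting_twoTwo
    (hGR : (GelbartRogawski1991.UnitaryDualPair.cmSplittingDatum L e dV hdV hdV0 dW hdW hdW0).CompatibleSplitting)
    (h22 : ∀ τ : L →+* ℂ, ∃ i₀ i₁ j₀ j₁ : Fin N, i₀ ≠ i₁ ∧ j₀ ≠ j₁ ∧ (τ (dV i₀)).re < 0 ∧ (τ (dV i₁)).re < 0 ∧
      0 < (τ (dV j₀)).re ∧ 0 < (τ (dV j₁)).re ∧ ∀ i, i ≠ i₀ → i ≠ i₁ → 0 < (τ (dV i)).re)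
    (hW : ∀ τ : L →+* ℂ, (∀ j, 0 < (τ (dW j)).re) ∨ ∀ j, (τ (dW j)).re < 0) :
    HasThetaMajorants fun
      (p : ↥(UnitaryGroup.adelic (↥(maximalRealSubfield L)) L (IsCMField.complexConj L) N (Matrix.diagonal dV)) ×
        ↥(UnitaryGroup.adelic (↥(maximalRealSubfield L)) L (IsCMField.complexConj L) M (Matrix.diagonal dW)))
      (Φ : piSchwartzBruhat (↥(maximalRealSubfield L)) (Fin n)) =>
        adelicMpCont.omega (↥(maximalRealSubfield L)) (Fin n)
          (GelbartRogawski1991.UnitaryDualPair.adelicGram (↥(maximalRealSubfield L)) e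
            (GelbartRogawski1991.UnitaryDualPair.realDiagonal L dV hdV)
            (GelbartRogawski1991.UnitaryDualPair.realDiagonal L dW hdW))
          (GelbartRogawski1991.UnitaryDualPair.cmPairSplitting L e dV hdV hdV0 dW hdW hdW0 hGR p) Φ :=
  hasThetaMajorants_cmPairSplitting_canonical L e dV hdV hdV0 dW hdW hdW0 (fun _ => (1 : ℝ)) (fun _ => one_ne_zero)
    hGR (nonempty_anyLeviKAKInput_cm_twoTwo L dV hdV dW hdW h22 hW)

end CMTwo

end Literature.NumberTheory.Weil1964

end
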